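import Literature.AnabelianGeometry.SemiGraphs.ThetaRayFrameStep
import Literature.AnabelianGeometry.SemiGraphs.SubdivisionPaths
import HarnessLib

/-!
# Deep fixed points of the powers of the escaping element project onto fixed points of the element itself
# (typed-form audit of [SemiAnbd] Thm 3.7 (iv) clause 2 at `𝒢_θ`, row «B9·ANCHOR-FREE-PAIR», brick K-B4b/2)

Mochizuki, *Semi-graphs of anabelioids*, Publ. RIMS **42** (2006), §3, Theorem 3.7 (iii)/(iv) pp. 40–41, Lemma
1.8 (ii) p. 20, Remark 2.2.1 p. 24 [cite: MochizukiSemiAnbd2006, Thm 3.7(iv) p.41].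

PROOF-ONLY file (abc-iut cell, layer L3, seat abc-iut-L3-d4 gen 5; row «B9·ANCHOR-FREE-PAIR@𝒢_θ» (L3-lead
β50/γ10); frontier / erratum-grade label — typed-form audit of the cell's ∀-countable typing of Thm 3.7 (iv) at
abc-iut-L3-d1's countermodel `𝒢_θ(p,n)`, OUTSIDE the [IUTchIII] Cor. 3.12 cone; 0 definitions, no named fact).
Desk memo `HOME/staging/L3/L3-d4/g5/B9-ANCHOR-FREE-PAIR.md`, step (S2) = (♦).

* `thetaRayFreeProP_frame_induction` — the INDUCTION along a path of the subdivision of the deep tree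
  `𝔾̃_{N'}` all of whose nodes are fixed by `x = c^{p^m}`: the normalised invariant of K-B4b/1 (p-id of
  `ThetaRayFrameStep`) propagates from the start vertex to the end vertex (Lemma 1.8 (ii): a walk
  `v – b – e – b' – v'` crosses one edge in four steps; `SubdivisionPaths` step lemmas);
* `thetaRayFreeProP_deepFixed_proj_fixed` — **(♦)**: with the shallow level `n₀` fixed and its thresholds in
  force, at every deep level `N'` (beyond the frame-shift level, with all `x`-fixed vertices far), EVERY
  `x`-fixed vertex `yy` of `𝔾̃_{N'}` has `ρ_{n₀}(c)` fixing its image in `𝔾̃_{n₀}` — start the induction at the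
  standard far vertex of the apartment (`rayPointSeq`), where `ρ(x) = σ^{a^{p^m}}` and `ρ_{n₀}(c) = σ_{n₀}^{a}`,
  and walk along the geodesic to `yy` inside `Fix(x)`.

Nothing of [SemiAnbd] is asserted; nothing bears on [IUTchIII] Cor. 3.12; typed ≠ proved.
-/

noncomputable section

namespace Literature.AnabelianGeometry.SemiGraphs

open CategoryTheory Filter Topology Multiplicative
open ProfiniteSemiGraph ProfiniteSemiGraph.GaloisLevelData
open Literature.AnabelianGeometry.SemiGraphs.FreeProPRankTwo

namespace ProfiniteSemiGraph

variable (p : ℕ) [hp : Fact p.Prime] (n : ℕ → ℕ)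

/-- `σ_N^h` fixes the tree vertex of the point sequence (decomposition groups fix their vertex), in the
`ρ_N(g) = σ_N^h` form. [cite: MochizukiSemiAnbd2006, Thm 3.7(iii) p.41] -/
theorem treeAct_vertexMap_vertex_of_proj_eq (h36 : (thetaRayFreeProP p n).Prop36Hypotheses) {w : ℕ}
    (P : ((thetaRayFreeProP p n).galoisLevelData h36).PointSeq h36.isCountable w) (N : ℕ)
    (g : ((thetaRayFreeProP p n).galoisLevelData h36).temperedPi h36.isCountable) (h : Grp p)
    (hg : ((thetaRayFreeProP p n).galoisLevelData h36).proj h36.isCountable N g = P.gal N h) :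
    (((thetaRayFreeProP p n).galoisLevelData h36).treeAct h36.isCountable N g).hom.vertexMap (P.vertex N) =
      P.vertex N := by
  have h1 := P.treeAct_decompHom_vertexMap N h
  rw [((thetaRayFreeProP p n).galoisLevelData h36).treeAct_apply h36.isCountable, P.proj_decompHom] at h1
  rw [((thetaRayFreeProP p n).galoisLevelData h36).treeAct_apply h36.isCountable, hg]
  exact h1

/-- **THE INDUCTION along an `x`-fixed path of the deep tree** (see the module docstring): the normalised
invariant of `thetaRayFreeProP_frame_step` propagates from `P.vertex N'` to the end vertex `yy` of any path of
the subdivision of `𝔾̃_{N'}` whose end vertex is fixed by `x = c^{p^m}` (then all its nodes are), provided every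
`x`-fixed vertex is far for the shallow level `n₀`. [cite: MochizukiSemiAnbd2006, Thm 3.7(iv) p.41] -/
theorem thetaRayFreeProP_frame_induction (h36 : (thetaRayFreeProP p n).Prop36Hypotheses)
    (P₀ : ((thetaRayFreeProP p n).galoisLevelData h36).PointSeq h36.isCountable (0 : ℕ))
    (c : ((thetaRayFreeProP p n).galoisLevelData h36).temperedPi h36.isCountable) (Nc : ℕ → ℕ)
    (hN : ∀ j k, Nc j ≤ k →
      ((thetaRayFreeProP p n).galoisLevelData h36).proj h36.isCountable j c =
        ((thetaRayFreeProP p n).galoisLevelData h36).proj h36.isCountable j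
          ((rayPointSeq (D := (thetaRayFreeProP p n).galoisLevelData h36) thetaRay_ham thetaRay_hap
            thetaRay_hmp P₀ (k + 1)).decompHom
            ((thetaRayFreeProP p n).brHom (k, true) (k + 1) (thetaRay_hap k) (ofAdd (1 : ℤ_[p])))))
    (m N' : ℕ) {n₀ : ℕ} (hnN : n₀ ≤ N')
    (hne : (((thetaRayFreeProP p n).galoisLevelData h36).proj h36.isCountable n₀ c) ^ p ^ m ≠ 1)
    (d : ℕ)
    (hV : ∀ (w : ℕ) (P : ((thetaRayFreeProP p n).galoisLevelData h36).PointSeq h36.isCountable w) (v : Grp p),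
      v ∈ charOpenCore (Grp p) d → P.gal n₀ v = 1)
    (k₁ : ℕ) (htwist : ∀ k, k₁ ≤ k → ∀ g : Grp p, θ p (n k) g * g⁻¹ ∈ charOpenCore (Grp p) d)
    (hshift : ∀ (w : ℕ) (P : ((thetaRayFreeProP p n).galoisLevelData h36).PointSeq h36.isCountable w)
      (b₁ b₂ : ℕ × Bool) (hb₁ : SemiGraph.ray.abuts b₁ = some w) (hb₂ : SemiGraph.ray.abuts b₂ = some w)
      (f₁ f₂ y₁ y₂ : Grp p) (k k₂ : Multiplicative ℤ_[p]), ‖(p : ℤ_[p]) ^ m‖ ≤ ‖k₂.toAdd‖ →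
      y₁ = (thetaRayFreeProP p n).brHom b₁ w hb₁ k → y₂ = (thetaRayFreeProP p n).brHom b₂ w hb₂ k₂ →
      P.gal N' (f₁ * y₁ * f₁⁻¹) = P.gal N' (f₂ * y₂ * f₂⁻¹) →
      ∃ (π : Multiplicative ℤ_[p]) (y v : Grp p), y = (thetaRayFreeProP p n).brHom b₂ w hb₂ π ∧
        v ∈ charOpenCore (Grp p) d ∧ f₂⁻¹ * f₁ = y * v)
    (hfarx : ∀ y : (((thetaRayFreeProP p n).galoisLevelData h36).tree N').Vertex,
      (((thetaRayFreeProP p n).galoisLevelData h36).treeAct h36.isCountable N' (c ^ p ^ m)).hom.vertexMap y = y →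
        k₁ ≤ (((thetaRayFreeProP p n).galoisLevelData h36).treeProj N').vertexMap y ∧
        Nc n₀ + 1 ≤ (((thetaRayFreeProP p n).galoisLevelData h36).treeProj N').vertexMap y) :
    ∀ (L : ℕ) {w : ℕ} (P : ((thetaRayFreeProP p n).galoisLevelData h36).PointSeq h36.isCountable w)
      (b : ℕ × Bool) (hb : SemiGraph.ray.abuts b = some w) (l u : Multiplicative ℤ_[p]) (y yu : Grp p),
      y = (thetaRayFreeProP p n).brHom b w hb l → yu = (thetaRayFreeProP p n).brHom b w hb u →
      ‖(p : ℤ_[p]) ^ m‖ ≤ ‖l.toAdd‖ →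
      ((thetaRayFreeProP p n).galoisLevelData h36).proj h36.isCountable N' (c ^ p ^ m) = P.gal N' y →
      ((thetaRayFreeProP p n).galoisLevelData h36).proj h36.isCountable n₀ c = P.gal n₀ yu →
      ∀ (yy : (((thetaRayFreeProP p n).galoisLevelData h36).tree N').Vertex)
        (q : (((thetaRayFreeProP p n).galoisLevelData h36).tree N').subdivision.Walk (Sum.inl (P.vertex N'))
          (Sum.inl yy)), q.IsPath → q.length ≤ L →
        (((thetaRayFreeProP p n).galoisLevelData h36).treeAct h36.isCountable N' (c ^ p ^ m)).hom.vertexMap yy = yy →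
        ∃ (w' : ℕ) (P' : ((thetaRayFreeProP p n).galoisLevelData h36).PointSeq h36.isCountable w')
          (b' : ℕ × Bool) (hb' : SemiGraph.ray.abuts b' = some w') (l' : Multiplicative ℤ_[p]) (y' yu' : Grp p),
          y' = (thetaRayFreeProP p n).brHom b' w' hb' l' ∧ yu' = (thetaRayFreeProP p n).brHom b' w' hb' u ∧
          ‖(p : ℤ_[p]) ^ m‖ ≤ ‖l'.toAdd‖ ∧
          ((thetaRayFreeProP p n).galoisLevelData h36).proj h36.isCountable N' (c ^ p ^ m) = P'.gal N' y' ∧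
          ((thetaRayFreeProP p n).galoisLevelData h36).proj h36.isCountable n₀ c = P'.gal n₀ yu' ∧
          P'.vertex N' = yy := by
  classical
  let Dg := (thetaRayFreeProP p n).galoisLevelData h36
  have hc36 := h36.isCountable
  have hT := (Dg.isTree_tree N').isTree
  intro L
  induction L with
  | zero =>
    intro w P b hb l u y yu hy hyu hl hI1 hI2 yy q hq hL hyy
    have h0 : q.length = 0 := Nat.le_zero.mp hL
    have hend : Sum.inl (P.vertex N') = (Sum.inl yy : (Dg.tree N').Node) := by
      have h1 := q.getVert_length
      rw [h0, q.getVert_zero] at h1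
      exact h1
    exact ⟨w, P, b, hb, l, y, yu, hy, hyu, hl, hI1, hI2, Sum.inl_injective hend⟩
  | succ L ih =>
    intro w P b hb l u y yu hy hyu hl hI1 hI2 yy q hq hL hyy
    by_cases hlen : q.length = 0
    · have hend : Sum.inl (P.vertex N') = (Sum.inl yy : (Dg.tree N').Node) := by
        have h1 := q.getVert_length
        rw [hlen, q.getVert_zero] at h1
        exact h1
      exact ⟨w, P, b, hb, l, y, yu, hy, hyu, hl, hI1, hI2, Sum.inl_injective hend⟩
    -- all nodes of `q` are fixed by `x`
    set σ := Dg.treeAct hc36 N' (c ^ p ^ m) with hσ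
    have hstart : σ.hom.vertexMap (P.vertex N') = P.vertex N' :=
      treeAct_vertexMap_vertex_of_proj_eq p n h36 P N' (c ^ p ^ m) y hI1
    have hall : ∀ z ∈ q.support, SemiGraph.nodeMap σ z = z :=
      SemiGraph.nodeMap_eq_self_of_isPath hT.isAcyclic σ (by simp [hstart]) (by simp [hyy]) q hq
    -- the first four nodes: `P.vertex N' – β – e – β' – v₁`
    have hx0 : q.getVert 0 = Sum.inl (P.vertex N') := q.getVert_zero
    have h0n : 0 < q.length := Nat.pos_of_ne_zero hlen
    obtain ⟨β, hβ, hx1⟩ := SemiGraph.step_vertex q h0n hx0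
    have h1n : 1 < q.length := SemiGraph.lt_length_of_getVert_ne q h0n (by rw [hx1]; simp)
    have hx2 : q.getVert 2 = Sum.inr (Sum.inl ((Dg.tree N').edgeOf β)) := by
      rcases SemiGraph.step_branch q h1n hx1 with h | ⟨v, hv, h⟩
      · exact h
      · exfalso
        have hvw : v = P.vertex N' := by rw [hβ] at hv; exact (Option.some.inj hv).symm
        exact SemiGraph.getVert_add_two_ne q hq (i := 0) (by omega) (by rw [h, hx0, hvw])
    have h2n : 2 < q.length := SemiGraph.lt_length_of_getVert_ne q h1n (by rw [hx2]; simp)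
    obtain ⟨β', hβ'e, hx3⟩ := SemiGraph.step_edge q h2n hx2
    have hββ' : β' ≠ β := by
      intro h
      exact SemiGraph.getVert_add_two_ne q hq (i := 1) (by omega) (by rw [hx3, hx1, h])
    have h3n : 3 < q.length := SemiGraph.lt_length_of_getVert_ne q h2n (by rw [hx3]; simp)
    obtain ⟨v₁, hβ'v, hx4⟩ : ∃ v₁ : (Dg.tree N').Vertex, (Dg.tree N').abuts β' = some v₁ ∧
        q.getVert 4 = Sum.inl v₁ := by
      rcases SemiGraph.step_branch q h3n hx3 with h | h
      · exfalso
        exact SemiGraph.getVert_add_two_ne q hq (i := 2) (by omega) (by rw [h, hx2, hβ'e])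
      · exact h
    -- `x` fixes `β`
    have hfixβ : σ.hom.branchMap β = β := by
      have h1 := hall (q.getVert 1) (q.getVert_mem_support 1)
      rw [hx1] at h1
      simpa only [SemiGraph.nodeMap_inr_inr, Sum.inr.injEq] using h1
    -- the current vertex is far for the shallow level
    obtain ⟨hw₁, hw₂⟩ : k₁ ≤ w ∧ Nc n₀ + 1 ≤ w := by
      have h1 := hfarx (P.vertex N') hstart
      rw [P.treeProj_vertexMap_vertex N'] at h1
      exact h1
    -- THE STEP
    obtain ⟨w', P', b', hb', l', y', yu', hy', hyu', hl', hI1', hI2', hjoins, hneq⟩ :=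
      thetaRayFreeProP_frame_step p n h36 P₀ c Nc hN m N' hnN hne d hV k₁ htwist hshift hw₁ hw₂ P b hb l u y
        yu hy hyu hl hI1 hI2 β hβ hfixβ
    -- the vertex reached is `v₁`
    have hv₁ : P'.vertex N' = v₁ := by
      obtain ⟨β₁, β₂, hβne, hβ₁e, hβ₂e, hβ₁a, hβ₂a⟩ := hjoins
      -- `β₁` abuts to `P.vertex N'` like `β`, hence `β₁ = β` (tree), so `β₂ = β'`
      have hβ₁β : β₁ = β := SemiGraph.branch_unique_of_isAcyclic hT.isAcyclic hβ₁e hβ₁a hβ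
      have hβ₂β' : β₂ = β' :=
        SemiGraph.branch_eq_of_ne_of_ne rfl hβ₂e hβ'e (by rw [← hβ₁β]; exact hβne.symm) hββ'
      rw [hβ₂β', hβ'v] at hβ₂a
      exact (Option.some.inj hβ₂a).symm
    -- the remaining path from `v₁`
    have hx4' : q.getVert 4 = Sum.inl (P'.vertex N') := by rw [hx4, hv₁]
    let q' : (Dg.tree N').subdivision.Walk (Sum.inl (P'.vertex N')) (Sum.inl yy) := (q.drop 4).copy hx4' rfl
    have hq' : q'.IsPath := by
      simp only [q', SimpleGraph.Walk.isPath_copy]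
      exact hq.drop 4
    have hL' : q'.length ≤ L := by
      simp only [q', SimpleGraph.Walk.length_copy, SimpleGraph.Walk.drop_length]
      omega
    exact ih P' b' hb' l' u y' yu' hy' hyu' hl' hI1' hI2' yy q' hq' hL' hyy

/-- **(♦) DEEP FIXED POINTS OF `c^{p^m}` PROJECT ONTO FIXED POINTS OF `c`.**  At `𝒢_θ(p,n)`, with the shallow
level `n₀` and its thresholds fixed (`ρ_{n₀}(c)^{p^m} ≠ 1`; the core `G(d)` killed at level `n₀`; far twists
trivial mod `G(d)`; frame shift in force at the deep level `N' ≥ n₀`; all `c^{p^m}`-fixed vertices of `𝔾̃_{N'}`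
far), every vertex of `𝔾̃_{N'}` fixed by `c^{p^m}` maps to a vertex of `𝔾̃_{n₀}` fixed by `c`.
[cite: MochizukiSemiAnbd2006, Thm 3.7(iv) p.41] -/
theorem thetaRayFreeProP_deepFixed_proj_fixed (h36 : (thetaRayFreeProP p n).Prop36Hypotheses)
    (P₀ : ((thetaRayFreeProP p n).galoisLevelData h36).PointSeq h36.isCountable (0 : ℕ))
    (c : ((thetaRayFreeProP p n).galoisLevelData h36).temperedPi h36.isCountable) (Nc : ℕ → ℕ)
    (hN : ∀ j k, Nc j ≤ k →
      ((thetaRayFreeProP p n).galoisLevelData h36).proj h36.isCountable j c =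
        ((thetaRayFreeProP p n).galoisLevelData h36).proj h36.isCountable j
          ((rayPointSeq (D := (thetaRayFreeProP p n).galoisLevelData h36) thetaRay_ham thetaRay_hap
            thetaRay_hmp P₀ (k + 1)).decompHom
            ((thetaRayFreeProP p n).brHom (k, true) (k + 1) (thetaRay_hap k) (ofAdd (1 : ℤ_[p])))))
    (m N' : ℕ) {n₀ : ℕ} (hnN : n₀ ≤ N')
    (hne : (((thetaRayFreeProP p n).galoisLevelData h36).proj h36.isCountable n₀ c) ^ p ^ m ≠ 1)
    (d : ℕ)
    (hV : ∀ (w : ℕ) (P : ((thetaRayFreeProP p n).galoisLevelData h36).PointSeq h36.isCountable w) (v : Grp p),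
      v ∈ charOpenCore (Grp p) d → P.gal n₀ v = 1)
    (k₁ : ℕ) (htwist : ∀ k, k₁ ≤ k → ∀ g : Grp p, θ p (n k) g * g⁻¹ ∈ charOpenCore (Grp p) d)
    (hshift : ∀ (w : ℕ) (P : ((thetaRayFreeProP p n).galoisLevelData h36).PointSeq h36.isCountable w)
      (b₁ b₂ : ℕ × Bool) (hb₁ : SemiGraph.ray.abuts b₁ = some w) (hb₂ : SemiGraph.ray.abuts b₂ = some w)
      (f₁ f₂ y₁ y₂ : Grp p) (k k₂ : Multiplicative ℤ_[p]), ‖(p : ℤ_[p]) ^ m‖ ≤ ‖k₂.toAdd‖ →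
      y₁ = (thetaRayFreeProP p n).brHom b₁ w hb₁ k → y₂ = (thetaRayFreeProP p n).brHom b₂ w hb₂ k₂ →
      P.gal N' (f₁ * y₁ * f₁⁻¹) = P.gal N' (f₂ * y₂ * f₂⁻¹) →
      ∃ (π : Multiplicative ℤ_[p]) (y v : Grp p), y = (thetaRayFreeProP p n).brHom b₂ w hb₂ π ∧
        v ∈ charOpenCore (Grp p) d ∧ f₂⁻¹ * f₁ = y * v)
    (hfarx : ∀ y : (((thetaRayFreeProP p n).galoisLevelData h36).tree N').Vertex,
      (((thetaRayFreeProP p n).galoisLevelData h36).treeAct h36.isCountable N' (c ^ p ^ m)).hom.vertexMap y = y →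
        k₁ ≤ (((thetaRayFreeProP p n).galoisLevelData h36).treeProj N').vertexMap y ∧
        Nc n₀ + 1 ≤ (((thetaRayFreeProP p n).galoisLevelData h36).treeProj N').vertexMap y)
    (yy : (((thetaRayFreeProP p n).galoisLevelData h36).tree N').Vertex)
    (hyy : (((thetaRayFreeProP p n).galoisLevelData h36).treeAct h36.isCountable N' (c ^ p ^ m)).hom.vertexMap yy
      = yy) :
    (((thetaRayFreeProP p n).galoisLevelData h36).treeAct h36.isCountable n₀ c).hom.vertexMap
        ((((thetaRayFreeProP p n).galoisLevelData h36).treeTrans hnN).vertexMap yy) =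
      (((thetaRayFreeProP p n).galoisLevelData h36).treeTrans hnN).vertexMap yy := by
  classical
  let Dg := (thetaRayFreeProP p n).galoisLevelData h36
  have hc36 := h36.isCountable
  have hT := (Dg.isTree_tree N').isTree
  -- the standard far vertex `s̃ = (rayPointSeq (ks+1)).vertex N'`, `ks ≥ Nc N', Nc n₀`
  set ks : ℕ := max (Nc N') (Nc n₀) with hks
  set Ps := rayPointSeq (D := Dg) thetaRay_ham thetaRay_hap thetaRay_hmp P₀ (ks + 1) with hPs
  let brs : Multiplicative ℤ_[p] →* Grp p :=
    (MonoidHom.id (Grp p)).comp ((thetaRayFreeProP p n).brHom (ks, true) (ks + 1) (thetaRay_hap ks)).toMonoidHom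
  have hbrs : ∀ t, brs t = (thetaRayFreeProP p n).brHom (ks, true) (ks + 1) (thetaRay_hap ks) t :=
    fun t => rfl
  have habuts : SemiGraph.ray.abuts (ks, true) = some (ks + 1) := rfl
  -- (I2) at the start: `ρ_{n₀}(c) = σ_{n₀}^{a}`
  have hI2 : Dg.proj hc36 n₀ c = Ps.gal n₀ (brs (ofAdd 1)) := by
    rw [hN n₀ ks (le_max_right _ _)]
    rfl
  -- (I1) at the start: `ρ_{N'}(c^{p^m}) = σ_{N'}^{a^{p^m}}`
  have hI1 : Dg.proj hc36 N' (c ^ p ^ m) = Ps.gal N' (brs (ofAdd ((p : ℤ_[p]) ^ m))) := by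
    have h1 : Dg.proj hc36 N' c = Ps.gal N' (brs (ofAdd 1)) := by
      rw [hN N' ks (le_max_left _ _)]
      rfl
    have h2 : (ofAdd (1 : ℤ_[p])) ^ p ^ m = ofAdd ((p : ℤ_[p]) ^ m) := by
      rw [← ofAdd_nsmul, nsmul_eq_mul, mul_one, Nat.cast_pow]
    have h3 : brs (ofAdd ((p : ℤ_[p]) ^ m)) = (brs (ofAdd 1)) ^ p ^ m := by rw [← map_pow, h2]
    rw [h3, map_pow, h1]
    exact (Ps.gal_pow N' _ (p ^ m)).symm
  -- the geodesic from `s̃` to `yy`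
  let q : (Dg.tree N').subdivision.Path (Sum.inl (Ps.vertex N')) (Sum.inl yy) :=
    (hT.connected (Sum.inl (Ps.vertex N')) (Sum.inl yy)).some.toPath
  obtain ⟨w', P', b', hb', l', y', yu', -, hyu', -, -, hI2', hv⟩ :=
    thetaRayFreeProP_frame_induction p n h36 P₀ c Nc hN m N' hnN hne d hV k₁ htwist hshift hfarx q.1.length Ps
      (ks, true) habuts (ofAdd ((p : ℤ_[p]) ^ m)) (ofAdd 1) (brs (ofAdd ((p : ℤ_[p]) ^ m))) (brs (ofAdd 1))
      (hbrs _) (hbrs _) (by rw [toAdd_ofAdd]) hI1 hI2 yy q.1 q.2 le_rfl hyy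
  -- `ρ_{n₀}(c) = σ_{n₀}^{b'_*(u)}` at `P'`, so it fixes `P'.vertex n₀ = tr(yy)`
  have hfix := treeAct_vertexMap_vertex_of_proj_eq p n h36 P' n₀ c yu' hI2'
  rw [← P'.treeTrans_vertex hnN, hv] at hfix
  exact hfix

end ProfiniteSemiGraph

end Literature.AnabelianGeometry.SemiGraphs

end
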